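import Mathlib
import HarnessLib
import Summits.Ventures.LatticeQCDFlow.Exactness.FlowPushforward
import Summits.Ventures.LatticeQCDFlow.Exactness.GaugeEquivariance
import Literature.MathematicalPhysics.QuantumFieldTheory.ConstructiveQFTWave0Proofs

/-!
# Exact Jacobians of gauge-equivariant layers are gauge invariant

HONEST FRAMING: exact (Metropolis-corrected) sampling algorithms for lattice gauge theory;
figures of merit are autocorrelation/cost numbers at stated couplings and volumes; no
continuum-physics claim.

Venture `LatticeQCDFlow` (cell pub-lqcd), topic `Exactness`; FANOUT row 10 (`eng-equiv`: the equivariance unit tests of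
`latflow.equiv` / `flows_jax` — "log-det gauge invariance").  NEW WORK of the cell; pure measure theory plus the tree's
gauge-invariance of product Haar; no definition; nothing cited as a fact; independent of the residual-layer series.

* **`HasJacobian.comp_symm_of_comm`** — if `F` has exact Jacobian `J` for `vol`, `T` is a measurable automorphism
  preserving `vol` and commuting with `F`, then `J ∘ T` is also an exact Jacobian of `F`;
  **`HasJacobian.jac_comp_symm_eq`** — hence a CONTINUOUS exact Jacobian of an automorphism is `T`-invariant when `vol`
  charges open sets (two exact Jacobians of one automorphism agree a.e.; `Continuous.ae_eq_iff_eq`);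
* `exists_measurableEquiv_gaugeTransform`, `continuous_gaugeTransform_config`, **`isGaugeInvariant_of_hasJacobian`** — for
  every compact group `G`: the continuous nonnegative exact Jacobian (for `⊗_e Haar_G`) of a gauge-EQUIVARIANT measurable
  automorphism of `G^E` is gauge INVARIANT — discharging the hypothesis `IsGaugeInvariant J` of
  `GaugeEquivariance.isGaugeInvariant_modelDensity` (model density and importance weights of an equivariant flow are class
  functions) for every layer with a continuous exact Jacobian (`WilsonGauge.measurePreserving_gaugeTransform`);
  `isGaugeInvariant_modelDensity_of_hasJacobian` — that corollary spelled out.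

Printed counterparts, NAMED ONLY: Lüscher, CMP 293 (2010) 899, §2.3–§2.4; Kanwar et al., PRL 125 (2020) 121601;
Boyda et al., PRD 103 (2021) 074504 (gauge-equivariant flows).
-/

noncomputable section

namespace Summit.Ventures.LatticeQCDFlow.Exactness

open Literature.MathematicalPhysics.QuantumFieldTheory
open MeasureTheory Filter Set
open scoped Topology ENNReal

/-! ## Exact Jacobians of maps commuting with a measure-preserving symmetry -/

section General

variable {Ω : Type*} [MeasurableSpace Ω]

/-- **A symmetry of the flow transports its exact Jacobian.**  If `F` has exact Jacobian `J` for `vol`,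
`T` is a measurable automorphism preserving `vol`, and `F` commutes with `T`, then `J ∘ T` is ALSO an exact
Jacobian of `F`. -/
theorem HasJacobian.comp_symm_of_comm {vol : Measure Ω} {F : Ω → Ω} {J : Ω → ℝ≥0∞}
    (h : HasJacobian vol F J) (T : Ω ≃ᵐ Ω) (hT : MeasurePreserving T vol vol)
    (hcomm : ∀ x, F (T x) = T (F x)) : HasJacobian vol F (J ∘ T) := by
  have hTs : MeasurePreserving T.symm vol vol := hT.symm T
  -- `(J ∘ T) · vol = T⁻¹_* (J · vol)`
  have hpull : vol.withDensity (J ∘ T) = Measure.map T.symm (vol.withDensity J) := by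
    have h1 : (vol.withDensity J) = vol.withDensity (fun z => (J ∘ T) (T.symm z)) := by
      congr 1
      funext z
      simp only [Function.comp_apply, MeasurableEquiv.apply_symm_apply]
    rw [h1, map_withDensity_comp_eq T.symm.measurable (h.measurable_jac.comp T.measurable), hTs.map_eq]
  -- `F ∘ T⁻¹ = T⁻¹ ∘ F`
  have hcomm' : ∀ x, F (T.symm x) = T.symm (F x) := fun x => by
    apply T.injective
    rw [← hcomm, MeasurableEquiv.apply_symm_apply, MeasurableEquiv.apply_symm_apply]
  refine ⟨h.measurable, h.measurable_jac.comp T.measurable, ?_⟩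
  rw [hpull, Measure.map_map h.measurable T.symm.measurable]
  have hfun : F ∘ T.symm = T.symm ∘ F := funext hcomm'
  rw [hfun, ← Measure.map_map T.symm.measurable h.measurable, h.map_eq, hTs.map_eq]

/-- **… so a CONTINUOUS exact Jacobian of an automorphism is invariant under the symmetry** (two exact
Jacobians of the same automorphism agree a.e., `HasJacobian.jac_ae_eq`; continuity and a measure charging
open sets upgrade a.e. to everywhere). -/
theorem HasJacobian.jac_comp_symm_eq [TopologicalSpace Ω] [OpensMeasurableSpace Ω] {vol : Measure Ω}
    [SigmaFinite vol] [vol.IsOpenPosMeasure] {F : Ω ≃ᵐ Ω} {j : Ω → ℝ} (hj : Continuous j)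
    (h : HasJacobian vol F (fun x => ENNReal.ofReal (j x))) (T : Ω ≃ᵐ Ω) (hT : MeasurePreserving T vol vol)
    (hTc : Continuous T) (hcomm : ∀ x, F (T x) = T (F x)) (x : Ω) :
    ENNReal.ofReal (j (T x)) = ENNReal.ofReal (j x) := by
  have h2 : HasJacobian vol F ((fun x => ENNReal.ofReal (j x)) ∘ T) := h.comp_symm_of_comm T hT hcomm
  -- two exact Jacobians of the same automorphism agree a.e. (both make `J · vol` equal to `F⁻¹_* vol`)
  have hm : ∀ K : Ω → ℝ≥0∞, HasJacobian vol F K → vol.withDensity K = Measure.map F.symm vol := by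
    intro K hK
    calc vol.withDensity K = Measure.map F.symm (Measure.map F (vol.withDensity K)) := by
          rw [Measure.map_map F.symm.measurable F.measurable, F.symm_comp_self, Measure.map_id]
      _ = Measure.map F.symm vol := by rw [hK.map_eq]
  have hae : ((fun x => ENNReal.ofReal (j x)) ∘ T) =ᵐ[vol] (fun x => ENNReal.ofReal (j x)) :=
    (withDensity_eq_iff_of_sigmaFinite h2.measurable_jac.aemeasurable h.measurable_jac.aemeasurable).1
      ((hm _ h2).trans (hm _ h).symm)
  have hc1 : Continuous ((fun x => ENNReal.ofReal (j x)) ∘ T) :=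
    (ENNReal.continuous_ofReal.comp hj).comp hTc
  have hc2 : Continuous (fun x => ENNReal.ofReal (j x)) := ENNReal.continuous_ofReal.comp hj
  have heq := (Continuous.ae_eq_iff_eq vol hc1 hc2).1 hae
  exact congrFun heq x

end General

/-! ## Gauge invariance of continuous exact Jacobians of equivariant layers -/

section Gauge

variable {d L : ℕ} [NeZero L] {G : Type*} [Group G] [TopologicalSpace G] [IsTopologicalGroup G]
  [CompactSpace G] [MeasurableSpace G] [BorelSpace G]

/-- The gauge transformation by `g` as a measurable automorphism of `G^E` (inverse: the transformation by
`g⁻¹`). -/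
theorem exists_measurableEquiv_gaugeTransform (g : Site d L → G) :
    ∃ T : GaugeConfig d L G ≃ᵐ GaugeConfig d L G, ⇑T = gaugeTransform g := by
  refine ⟨{ toFun := gaugeTransform g
            invFun := gaugeTransform g⁻¹
            left_inv := fun U => funext fun e => by simp [gaugeTransform, mul_assoc]
            right_inv := fun U => funext fun e => by simp [gaugeTransform, mul_assoc]
            measurable_toFun := (WilsonGauge.measurePreserving_gaugeTransform g).measurable
            measurable_invFun := (WilsonGauge.measurePreserving_gaugeTransform g⁻¹).measurable }, rfl⟩

omit [MeasurableSpace G] [BorelSpace G] [CompactSpace G] [NeZero L] in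
/-- Gauge transformations are continuous. -/
theorem continuous_gaugeTransform_config (g : Site d L → G) :
    Continuous (gaugeTransform g : GaugeConfig d L G → GaugeConfig d L G) := by
  refine continuous_pi fun e => ?_
  exact (continuous_const.mul (continuous_apply e)).mul continuous_const

/-- **The continuous exact Jacobian of a gauge-equivariant automorphism of `G^E` is gauge invariant.**
For a measurable automorphism `Ψ` of `G^E` commuting with all gauge transformations and a continuous
`j ≥ 0` with `HasJacobian (⊗_e Haar_G) Ψ (ofReal ∘ j)`: `j(U^g) = j(U)`.  This DISCHARGES the hypothesis
`IsGaugeInvariant J` of `GaugeEquivariance.isGaugeInvariant_modelDensity` ("the model density / importance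
weights of an equivariant flow are class functions") for every layer with a continuous exact Jacobian. -/
theorem isGaugeInvariant_of_hasJacobian [SecondCountableTopology G] {Ψ : GaugeConfig d L G ≃ᵐ GaugeConfig d L G}
    (hΨ : IsGaugeEquivariant (Ψ : GaugeConfig d L G → GaugeConfig d L G)) {j : GaugeConfig d L G → ℝ}
    (hj : Continuous j) (hj0 : ∀ U, 0 ≤ j U)
    (h : HasJacobian (Measure.pi fun _ : Edge d L => haarProbability G) Ψ (fun U => ENNReal.ofReal (j U))) :
    IsGaugeInvariant j := by
  haveI : (haarProbability G).IsOpenPosMeasure := by unfold haarProbability; infer_instance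
  intro g U
  obtain ⟨T, hT⟩ := exists_measurableEquiv_gaugeTransform (d := d) (L := L) g
  have hTp : MeasurePreserving T (Measure.pi fun _ : Edge d L => haarProbability G)
      (Measure.pi fun _ : Edge d L => haarProbability G) := by
    rw [show (T : GaugeConfig d L G → GaugeConfig d L G) = gaugeTransform g from hT]
    exact WilsonGauge.measurePreserving_gaugeTransform g
  have hTc : Continuous T := by rw [hT]; exact continuous_gaugeTransform_config g
  have hcomm : ∀ x, Ψ (T x) = T (Ψ x) := fun x => by rw [hT]; exact hΨ g x
  have h1 := HasJacobian.jac_comp_symm_eq hj h T hTp hTc hcomm U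
  rw [hT] at h1
  exact (ENNReal.ofReal_eq_ofReal_iff (hj0 _) (hj0 _)).1 h1

/-- **Corollary: the model density of an equivariant flow with a continuous exact Jacobian is a class function**
— `GaugeEquivariance.isGaugeInvariant_modelDensity` with its Jacobian hypothesis discharged: for a gauge-invariant
prior density `r`, the push-forward density `(r / j) ∘ Ψ⁻¹` is gauge invariant. -/
theorem isGaugeInvariant_modelDensity_of_hasJacobian [SecondCountableTopology G]
    {Ψ : GaugeConfig d L G ≃ᵐ GaugeConfig d L G}
    (hΨ : IsGaugeEquivariant (Ψ : GaugeConfig d L G → GaugeConfig d L G)) {j r : GaugeConfig d L G → ℝ}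
    (hj : Continuous j) (hj0 : ∀ U, 0 ≤ j U)
    (h : HasJacobian (Measure.pi fun _ : Edge d L => haarProbability G) Ψ (fun U => ENNReal.ofReal (j U)))
    (hr : IsGaugeInvariant r) :
    IsGaugeInvariant fun U => r (Ψ.symm U) / j (Ψ.symm U) :=
  isGaugeInvariant_modelDensity (F := Ψ.toEquiv) hr (isGaugeInvariant_of_hasJacobian hΨ hj hj0 h) hΨ

end Gauge

end Summit.Ventures.LatticeQCDFlow.Exactness

end

/-! ## Measurable (not necessarily continuous) Jacobians: invariance almost everywhere; stacks of layers (GEN-13 append)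

The first part needs `j` CONTINUOUS to conclude `j(U^g) = j(U)` everywhere.  The booked Jacobians of the SPECTRAL
coupling layers are only measurable (chart-wise formulas, the alcove walls a null set), so for them the honest
statement is almost-everywhere invariance, which needs no topology on the Jacobian at all:
* **`HasJacobian.jac_comp_symm_ae_eq`** — any exact Jacobian `J` (for a σ-finite `vol`) of a measurable automorphism
  `F` satisfies `J ∘ T = J` `vol`-a.e. for every `vol`-preserving symmetry `T` commuting with `F` (two exact Jacobians
  of one automorphism make `J · vol` equal to `F⁻¹_* vol`, hence agree a.e.);
* **`ae_gaugeInvariant_of_hasJacobian`** — for every compact `G`: a measurable exact Jacobian (for `⊗_e Haar_G`) of a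
  gauge-equivariant measurable automorphism of `G^E` is invariant under each gauge transformation almost everywhere.
The engine composes layers and books the SUM of their log-dets, and reads the model density through the inverse pass:
* `hasJacobian_trans_of_nonneg` / **`isGaugeInvariant_jac_trans`** — for gauge-equivariant automorphisms `Ψ₁`
  (continuous), `Ψ₂` with continuous nonnegative exact Jacobians `j₁`, `j₂`, the stack `Ψ₂ ∘ Ψ₁` has the exact
  Jacobian `U ↦ j₂ (Ψ₁ U) · j₁ U` (`HasJacobian.comp`) and this accumulated Jacobian is a class function;
* `isGaugeInvariant_jac_comp_symm` — a class function read through the inverse pass of an equivariant automorphism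
  is a class function.
-/

noncomputable section

namespace Summit.Ventures.LatticeQCDFlow.Exactness

open Literature.MathematicalPhysics.QuantumFieldTheory
open MeasureTheory Filter Set
open scoped Topology ENNReal

section AlmostEverywhere

variable {Ω : Type*} [MeasurableSpace Ω]

/-- **Two exact Jacobians of one automorphism agree a.e.; hence an exact Jacobian is a.e. invariant under every
measure-preserving symmetry commuting with the map** — no continuity needed. -/
theorem HasJacobian.jac_comp_symm_ae_eq {vol : Measure Ω} [SigmaFinite vol] {F : Ω ≃ᵐ Ω} {J : Ω → ℝ≥0∞}
    (h : HasJacobian vol F J) (T : Ω ≃ᵐ Ω) (hT : MeasurePreserving T vol vol)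
    (hcomm : ∀ x, F (T x) = T (F x)) : (J ∘ T) =ᵐ[vol] J := by
  have h2 : HasJacobian vol F (J ∘ T) := h.comp_symm_of_comm T hT hcomm
  have hm : ∀ K : Ω → ℝ≥0∞, HasJacobian vol F K → vol.withDensity K = Measure.map F.symm vol := by
    intro K hK
    calc vol.withDensity K = Measure.map F.symm (Measure.map F (vol.withDensity K)) := by
          rw [Measure.map_map F.symm.measurable F.measurable, F.symm_comp_self, Measure.map_id]
      _ = Measure.map F.symm vol := by rw [hK.map_eq]
  exact (withDensity_eq_iff_of_sigmaFinite h2.measurable_jac.aemeasurable h.measurable_jac.aemeasurable).1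
    ((hm _ h2).trans (hm _ h).symm)

end AlmostEverywhere

section Gauge

variable {d L : ℕ} [NeZero L] {G : Type*} [Group G] [TopologicalSpace G] [IsTopologicalGroup G]
  [CompactSpace G] [MeasurableSpace G] [BorelSpace G]

/-- **A measurable exact Jacobian of a gauge-equivariant automorphism of `G^E` is gauge invariant almost
everywhere**: for every gauge transformation `g`, `J (U^g) = J U` for `⊗_e Haar_G`-a.e. `U`.  (Applies to the
spectral coupling layers, whose booked Jacobians are measurable but not continuous.) -/
theorem ae_gaugeInvariant_of_hasJacobian {Ψ : GaugeConfig d L G ≃ᵐ GaugeConfig d L G}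
    (hΨ : IsGaugeEquivariant (Ψ : GaugeConfig d L G → GaugeConfig d L G)) {J : GaugeConfig d L G → ℝ≥0∞}
    (h : HasJacobian (Measure.pi fun _ : Edge d L => haarProbability G) Ψ J) (g : Site d L → G) :
    ∀ᵐ U ∂(Measure.pi fun _ : Edge d L => haarProbability G), J (gaugeTransform g U) = J U := by
  obtain ⟨T, hT⟩ := exists_measurableEquiv_gaugeTransform (d := d) (L := L) g
  have hTp : MeasurePreserving T (Measure.pi fun _ : Edge d L => haarProbability G)
      (Measure.pi fun _ : Edge d L => haarProbability G) := by
    rw [show (T : GaugeConfig d L G → GaugeConfig d L G) = gaugeTransform g from hT]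
    exact WilsonGauge.measurePreserving_gaugeTransform g
  have hcomm : ∀ x, Ψ (T x) = T (Ψ x) := fun x => by rw [hT]; exact hΨ g x
  have hae := h.jac_comp_symm_ae_eq T hTp hcomm
  rw [hT] at hae
  exact hae

omit [Group G] [TopologicalSpace G] [IsTopologicalGroup G] [CompactSpace G] [BorelSpace G] [NeZero L] in
/-- **Layers compose, Jacobians multiply** (continuous real form): if `Ψ₁`, `Ψ₂` have exact Jacobians
`ofReal ∘ j₁`, `ofReal ∘ j₂` with `j₂ ≥ 0`, then `Ψ₁.trans Ψ₂ = Ψ₂ ∘ Ψ₁` has the exact Jacobian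
`ofReal ∘ (U ↦ j₂ (Ψ₁ U) · j₁ U)`. -/
theorem hasJacobian_trans_of_nonneg {vol : Measure (GaugeConfig d L G)}
    {Ψ₁ Ψ₂ : GaugeConfig d L G ≃ᵐ GaugeConfig d L G} {j₁ j₂ : GaugeConfig d L G → ℝ}
    (hj₂0 : ∀ U, 0 ≤ j₂ U)
    (h₁ : HasJacobian vol Ψ₁ (fun U => ENNReal.ofReal (j₁ U)))
    (h₂ : HasJacobian vol Ψ₂ (fun U => ENNReal.ofReal (j₂ U))) :
    HasJacobian vol (Ψ₁.trans Ψ₂) (fun U => ENNReal.ofReal (j₂ (Ψ₁ U) * j₁ U)) := by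
  have h := h₂.comp h₁
  have hfun : (fun U => ENNReal.ofReal (j₂ (Ψ₁ U)) * ENNReal.ofReal (j₁ U)) =
      fun U => ENNReal.ofReal (j₂ (Ψ₁ U) * j₁ U) := by
    funext U
    rw [ENNReal.ofReal_mul (hj₂0 _)]
  rw [hfun] at h
  exact h

/-- **The accumulated Jacobian of a stack of two gauge-equivariant layers is a class function.**  For
gauge-equivariant measurable automorphisms `Ψ₁` (continuous) and `Ψ₂` of `G^E` with continuous nonnegative
exact Jacobians `j₁`, `j₂` for product Haar: `U ↦ j₂ (Ψ₁ U) · j₁ U` — the exact Jacobian of `Ψ₂ ∘ Ψ₁` — is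
gauge invariant. -/
theorem isGaugeInvariant_jac_trans [SecondCountableTopology G]
    {Ψ₁ Ψ₂ : GaugeConfig d L G ≃ᵐ GaugeConfig d L G}
    (hΨ₁ : IsGaugeEquivariant (Ψ₁ : GaugeConfig d L G → GaugeConfig d L G))
    (hΨ₂ : IsGaugeEquivariant (Ψ₂ : GaugeConfig d L G → GaugeConfig d L G))
    (hΨ₁c : Continuous Ψ₁) {j₁ j₂ : GaugeConfig d L G → ℝ}
    (hj₁ : Continuous j₁) (hj₁0 : ∀ U, 0 ≤ j₁ U) (hj₂ : Continuous j₂) (hj₂0 : ∀ U, 0 ≤ j₂ U)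
    (h₁ : HasJacobian (Measure.pi fun _ : Edge d L => haarProbability G) Ψ₁ (fun U => ENNReal.ofReal (j₁ U)))
    (h₂ : HasJacobian (Measure.pi fun _ : Edge d L => haarProbability G) Ψ₂ (fun U => ENNReal.ofReal (j₂ U))) :
    IsGaugeInvariant fun U => j₂ (Ψ₁ U) * j₁ U := by
  have hΨ : IsGaugeEquivariant ((Ψ₁.trans Ψ₂ : GaugeConfig d L G ≃ᵐ GaugeConfig d L G) :
      GaugeConfig d L G → GaugeConfig d L G) := by
    have h := hΨ₂.comp hΨ₁
    exact h
  exact isGaugeInvariant_of_hasJacobian hΨ ((hj₂.comp hΨ₁c).mul hj₁)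
    (fun U => mul_nonneg (hj₂0 _) (hj₁0 _)) (hasJacobian_trans_of_nonneg hj₂0 h₁ h₂)

omit [TopologicalSpace G] [IsTopologicalGroup G] [CompactSpace G] [BorelSpace G] [NeZero L] in
/-- **The booked Jacobian read through the inverse pass is a class function**: if `j` is gauge invariant and
`Ψ` is a gauge-equivariant automorphism, then so is `j ∘ Ψ⁻¹`. -/
theorem isGaugeInvariant_jac_comp_symm {Ψ : GaugeConfig d L G ≃ᵐ GaugeConfig d L G}
    (hΨ : IsGaugeEquivariant (Ψ : GaugeConfig d L G → GaugeConfig d L G)) {α : Type*} {j : GaugeConfig d L G → α}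
    (hj : IsGaugeInvariant j) : IsGaugeInvariant fun U => j (Ψ.symm U) :=
  fun g U => by
    change j (Ψ.toEquiv.symm (gaugeTransform g U)) = j (Ψ.toEquiv.symm U)
    rw [(IsGaugeEquivariant.symm (F := Ψ.toEquiv) hΨ) g U, hj g]

end Gauge

end Summit.Ventures.LatticeQCDFlow.Exactness

end
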